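import Literature.NumberTheory.EllipticCurves.NewformGaloisRep
import Literature.NumberTheory.EllipticCurves.HasseWeilAbelian
import Literature.NumberTheory.EllipticCurves.CuspFormLFunction
import HarnessLib

/-!
# Carayol 1986, Thm. (A) read on the local Euler factors: the Frobenius characteristic
# polynomial on the inertia COINVARIANTS of the Galois representation of a newform at every
# `ℓ ≠ p` (named fact)

Topic `Literature/NumberTheory/EllipticCurves`.  ONE named fact, no proofs.  Sibling of
`NewformGaloisRepInertiaInvariants` (the inertia-INVARIANTS reading of the same theorem).

For a newform `g ∈ S_k(Γ₁(N))`, `k ≥ 2`, an isomorphism `ι : ℚ̄_p ≃ ℂ`, an irreducible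
`ρ : Γ_ℚ → GL₂(ℚ̄_p)` attached to `g` away from `Np` (`IsGaloisRepOfNewform1`), a prime `ℓ ≠ p`,
a prime `𝔔` of `ℤ̄` above `ℓ` and an arithmetic Frobenius `σ` at `𝔔`: the reversed characteristic
polynomial of `σ` on the inertia coinvariants `(ℚ̄_p²)_{I_𝔔}` is the Hecke polynomial
`1 - a_ℓ(g) T + χ_g(ℓ) ℓ^{k-1} T²` of `g` at `ℓ` (read in `ℚ̄_p` through `ι⁻¹`; for `ℓ ∣ N` the
nebentypus value `χ_g(ℓ)` is `0` and the factor has degree `≤ 1`).  This is Carayol's Théorème (A)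
— local–global compatibility `σ_λ(π)|_{W_ℓ} ≃ σ_λ(π_ℓ)` at every finite place (Carayol 1986,
(0.7) with (0.5), (0.8), pp. 410–411; over `ℚ` due to Langlands 1973, Deligne and Carayol) —
read on the local `L`-factors: "the `ℓ`-Euler factor of the `λ`-adic representation of a newform
is its `ℓ`-th Hecke factor" (Rohrlich 1997, §3.1 and §3.8, Thm. 5, in weight `2`).  At `ℓ ∤ Np`
it is the defining Eichler–Shimura/Deligne relation; the content is at `ℓ ∣ N`.

The statement is, character for character, the hypothesis `hC` of the ACCEPTED reductions
`hasEntireLFunction_baseChange_fixedField_of_modularity_of_carayol`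
(`AnalyticRankOverNumberFieldArtinProofs.lean`, p163377) and of its local engine in
`TateModuleTwistNewformEulerFactorsProofs.lean`, vendored as a named fact at the request of
promote event 4526670 (7 provefact sessions on `hasEntireLFunction_baseChange_fixedField`;
librarian sweep g40, 2026-08-17): with it that fact is one line modulo the existing named facts
`exists_isNewformOf` (modularity) and `Hida2000_thm326_exists_galoisRep` (Deligne's
representations).  Deliberately NOT here: the construction of `ρ_{g,ι}`, the Weil–Deligne
vocabulary, any proof.

## References

* H. Carayol, *Sur les représentations ℓ-adiques associées aux formes modulaires de Hilbert*,
  Ann. Sci. ÉNS (4) 19 (1986) 409–468, Thm. (A), (0.5), (0.7), (0.8) (pp. 410–411).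
  [CarayolASENS1986]
* D. Rohrlich, *Modular curves, Hecke correspondences, and L-functions*, in: Modular Forms and
  Fermat's Last Theorem (1997), §3.1, §3.8 Thm. 5, §3.9. [Rohrlich1997]
-/

noncomputable section

open scoped NumberField Polynomial MatrixGroups
open NumberField IsDedekindDomain Field Polynomial

namespace Literature.NumberTheory.EllipticCurves

open WeierstrassCurve CongruenceSubgroup
open Literature.NumberTheory.EllipticCurves.ModularForms
open Literature.NumberTheory.GaloisRepresentations

/-- **Carayol 1986, Thm. (A), Euler-factor form.**  For every newform `g ∈ S_k(Γ₁(N))`, `k ≥ 2`,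
every `ι : ℚ̄_p ≃ ℂ`, every irreducible `ρ : Γ_ℚ → GL₂(ℚ̄_p)` attached to `g` away from `Np`,
every prime `ℓ ≠ p`, every prime `𝔔` of `ℤ̄` above `ℓ` and every arithmetic Frobenius `σ` at
`𝔔` (`IsArithFrobAt`): the reversed characteristic polynomial of `σ` on the inertia coinvariants
of `ρ` at `𝔔` equals `1 - ι⁻¹(a_ℓ(g)) X + ι⁻¹(χ_g(ℓ) ℓ^{k-1}) X²` (Carayol's local–global
compatibility read on the `ℓ`-Euler factor; Rohrlich 1997 §3.8 Thm. 5).  Verbatim the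
hypothesis `hC` of `hasEntireLFunction_baseChange_fixedField_of_modularity_of_carayol`.
[cite: CarayolASENS1986, Thm. (A) (0.7) with (0.5), (0.8), pp. 410–411]
[cite: Rohrlich1997, §3.8 Thm. 5] -/
def Carayol1986_eulerFactor : Prop :=
  ∀ {N : ℕ} [NeZero N] {k : ℤ} (g : CuspForm (Gamma1 N) k), 2 ≤ k → IsNewform1 g →
    ∀ (p : ℕ) [Fact p.Prime] (ι : PadicAlgCl p ≃+* ℂ) (ρ : FramedGaloisRep ℚ (PadicAlgCl p) 2),
      IsGaloisRepOfNewform1 g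
        ((ι.symm : ℂ →+* PadicAlgCl p).comp (algebraMap (coeffCharField g) ℂ))
          {q | q ∣ N * p} ρ →
      ρ.toGaloisRep.IsIrreducible →
    ∀ ℓ : ℕ, ℓ.Prime → ℓ ≠ p →
    ∀ w : HeightOneSpectrum (𝓞 ℚ), (ℓ : 𝓞 ℚ) ∈ w.asIdeal → ∀ 𝔔 ∈ w.primesAbove,
    ∀ σ : 𝔔.decompositionSubgroup (absoluteGaloisGroup ℚ),
      IsArithFrobAt (𝓞 ℚ) (σ : absoluteGaloisGroup ℚ) 𝔔 →
      (ρ.toGaloisRep.toInertiaCoinvariants 𝔔 σ).charpoly.reverse =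
        1 - C (ι.symm (cuspCoeff g ℓ)) * X +
          C (ι.symm ((nebentypus g (ℓ : ZMod N) : ℂ) * (ℓ : ℂ) ^ (k - 1))) * X ^ 2

end Literature.NumberTheory.EllipticCurves

end
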